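import Summits.BirchSwinnertonDyer.BirchSwinnertonDyer.Theses.ShadowIsolation

/-!
# Evidence (lead c3, crux stmt-BirchSwinnertonDyer-15277): the deciding theorem of route `ShadowIsolation`
# re-glued with `PrimeSupplyIrreducible` (item 15491, provable now) in place of `R = ShaCotorsionReducible`
# — SAME IMPORT CONE as the route file

`closes : IsolationOfAccidentalZeros → PhantomShadow → SelmerRankUB → SelmerRankLB → SelmerRankSmallImage →
ShaCotorsionReducible → BirchSwinnertonDyer` (route file, rev 3) applies `R` only in the branch where the good
ordinary prime `p ≥ 5` drawn from `WeierstrassCurve.exists_good_ordinary_prime_holds` has `E[p]` REDUCIBLE.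
The route ALREADY carries the support item `PrimeSupplyIrreducible` (stmt-BirchSwinnertonDyer-15491: every
globally minimal elliptic `W/ℚ` has a good ordinary prime `p ≥ 5` with `E[p]` irreducible), marked
provable-now: it is literally the proved tree theorem
`WeierstrassCurve.exists_gt_mem_goodOrdinaryPrimes_hasIrreducibleModPGaloisRep W 4`
(`Literature/NumberTheory/EllipticCurves/ModPIrreducibleCofinite`, AEC Cor. IX.6.3 over `ℚ` + infinitely many
good ordinary primes; `#print axioms` = `propext`/`Classical.choice`/`Quot.sound`, re-checked 2026-08-17 by
lead c3), closable by a one-line THEOREMS file (which may import `ModPIrreducibleCofinite`; the route file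
need not). Taking the prime from the hypothesis `hPS : PrimeSupplyIrreducible` instead, the reducible branch
never occurs and `R` is never used: the theorem below has the conclusion of `closes`, its hypotheses MINUS
`hRed` PLUS `hPS`, and the body of `closes` otherwise verbatim (steps (A), (B), the glue `CruxesToTarget`,
the transport lemmas (T1)–(T3)). Its only import is the route file itself — the route's module cone is
UNCHANGED (this answers the rev-3 objection "importing the cofinite-irreducibility theorem would put the
Faltings/Shafarevich files into the module cone", which applied to lead c2's `ClosesWithoutR.lean`).

Independently, `R` is an OUTPUT of the route: `ShadowIsolationThesis → SelmerRankSmallImage →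
PrimeSupplyIrreducible → ShaCotorsionReducible` (Theorems file `ShadowIsolationShaCotorsionReducibleOfThesis`,
lead c3: `X` at an auxiliary irreducible prime gives `rank = r_an` by Greenberg's identity, `SmallImage` at the
Eisenstein prime gives `corank Sel_{p^∞} = r_an = rank`, hence `corank Ш[p^∞] = 0`). So among the hypotheses of
`closes` the crux `R` is REDUNDANT.

PLANNER RECIPE (D-0014; a `route edit`, not a prover action): `route edit --closes-file` with THIS body —
signature `closes : IsolationOfAccidentalZeros → PhantomShadow → SelmerRankUB → SelmerRankLB →
SelmerRankSmallImage → PrimeSupplyIrreducible → BirchSwinnertonDyer`; item stmt-15277 leaves the deciding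
theorem (it stays in the tree as an open crux = stmt-0132 restricted to the Eisenstein sector), item stmt-15491
enters it and is closed by `theorem primeSupplyIrreducible_proof : PrimeSupplyIrreducible := fun W _ _ => by
obtain ⟨p, h4, ⟨hp, hg, ho⟩, hi⟩ := W.exists_gt_mem_goodOrdinaryPrimes_hasIrreducibleModPGaloisRep 4; exact
⟨p, hp, h4, hg, ho, hi⟩`.

This file is EVIDENCE attached to the crux item. `lean check`: rc 0, sorries 0, axioms standard.
-/

-- D-0017: single-problem summit, so the namespace repeats BY DESIGN.
set_option linter.dupNamespace false

namespace Summit.BirchSwinnertonDyer.BirchSwinnertonDyer.Cruxes.ShaCotorsionReducible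

open scoped BigOperators Topology Classical
open Filter Set Function
open Literature
open Summit.BirchSwinnertonDyer.BirchSwinnertonDyer.Theses.ShadowIsolation

/-- **`closes` with `PrimeSupplyIrreducible` in place of `R`.** `IsolationOfAccidentalZeros → PhantomShadow →
SelmerRankUB → SelmerRankLB → SelmerRankSmallImage → PrimeSupplyIrreducible → BirchSwinnertonDyer`: the
route's deciding theorem with the hypothesis `hRed : ShaCotorsionReducible` REPLACED by the route's own
support item `hPS : PrimeSupplyIrreducible` (stmt-BirchSwinnertonDyer-15491, provable now), from which the good
ordinary prime `p ≥ 5` with `E[p]` IRREDUCIBLE is drawn; everything else is the body of `closes` verbatim.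
Only import: the route file. [cite: Greenberg1999LNM, §1 pp. 54–57] [cite: SilvermanAEC2009, Cor. IX.6.3] -/
theorem closes_with_primeSupplyIrreducible (hIso : IsolationOfAccidentalZeros) (hSh : PhantomShadow)
    (hUB : SelmerRankUB) (hLB : SelmerRankLB) (hSI : SelmerRankSmallImage)
    (hPS : PrimeSupplyIrreducible) :
    _root_.BirchSwinnertonDyer := by
  classical
  -- (A)+(B) support item `ShaUnboundedOfCorank`, PROVED inline (pure algebra of the corank formula
  -- `zpCorank A p = dim A[p] − dim A/pA`, Greenberg 1999 §1): if `shaCorank W p ≠ 0` then `Ш(W)` has an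
  -- element of every exact order `p ^ n`. (A) a FINITE group has corank formula `0`
  -- (`#ker (p•) = #A / #im (p•) = #(A/pA)` and `Nat.card = p ^ finrank`); (B) if no element of `Ш` has exact
  -- order `p ^ n` then `p ^ n` kills `Ш[p^∞]`, and `Ш[p^∞][p]` is finite (its `finrank` is positive since the
  -- corank formula is non-zero), so `Ш[p^∞] = Ш[p^∞][p^n]` is finite (`finite_torsionBy_pow`) — contradiction.
  have hzero : ∀ (B : Type) [AddCommGroup B] [Finite B] (p : ℕ) [Fact p.Prime],
      Literature.NumberTheory.EllipticCurves.zpCorank B p = 0 := by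
    intro B _ _ p hp
    unfold Literature.NumberTheory.EllipticCurves.zpCorank
    letI : Module (ZMod p) (AddSubgroup.torsionBy B (p : ℤ)) := AddSubgroup.torsionBy.zmodModule
    set φ : B →+ B := zsmulAddGroupHom (p : ℤ) with hφ
    have hker : ∀ x, x ∈ φ.ker ↔ x ∈ AddSubgroup.torsionBy B (p : ℤ) := by
      intro x
      simp [hφ, AddMonoidHom.mem_ker, Submodule.mem_torsionBy_iff]
    have hrange : ∀ x, x ∈ φ.range ↔
        x ∈ (LinearMap.range (LinearMap.lsmul ℤ B p)).toAddSubgroup := by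
      intro x
      simp [hφ, AddMonoidHom.mem_range, LinearMap.mem_range]
    have hkerEq : φ.ker = AddSubgroup.torsionBy B (p : ℤ) := AddSubgroup.ext hker
    have hrangeEq : φ.range = (LinearMap.range (LinearMap.lsmul ℤ B p)).toAddSubgroup :=
      AddSubgroup.ext hrange
    have h1 : Nat.card B = Nat.card (B ⧸ φ.ker) * Nat.card φ.ker :=
      AddSubgroup.card_eq_card_quotient_mul_card_addSubgroup _
    have h2 : Nat.card (B ⧸ φ.ker) = Nat.card φ.range :=
      Nat.card_congr (QuotientAddGroup.quotientKerEquivRange φ).toEquiv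
    have h3 : Nat.card B = Nat.card (B ⧸ φ.range) * Nat.card φ.range :=
      AddSubgroup.card_eq_card_quotient_mul_card_addSubgroup _
    have hpos : 0 < Nat.card φ.range := Nat.card_pos
    have hcard : Nat.card φ.ker = Nat.card (B ⧸ φ.range) := by
      rw [h2] at h1
      have h13 := h1.symm.trans h3
      rw [mul_comm] at h13
      exact Nat.eq_of_mul_eq_mul_right hpos h13
    have hcardK : Nat.card (AddSubgroup.torsionBy B (p : ℤ)) = Nat.card (ModN B p) := by
      rw [← hkerEq, hcard, hrangeEq]
      rfl
    haveI : Module.Finite (ZMod p) (AddSubgroup.torsionBy B (p : ℤ)) := Module.Finite.of_finite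
    haveI : Finite (ModN B p) :=
      Finite.of_surjective _ (Submodule.mkQ_surjective (LinearMap.range (LinearMap.lsmul ℤ B p)))
    haveI : Module.Finite (ZMod p) (ModN B p) := Module.Finite.of_finite
    have e1 := Module.natCard_eq_pow_finrank (K := ZMod p) (V := AddSubgroup.torsionBy B (p : ℤ))
    have e2 := Module.natCard_eq_pow_finrank (K := ZMod p) (V := ModN B p)
    rw [Nat.card_zmod] at e1 e2
    have : Module.finrank (ZMod p) (AddSubgroup.torsionBy B (p : ℤ)) =
        Module.finrank (ZMod p) (ModN B p) :=
      Nat.pow_right_injective hp.out.two_le (e1.symm.trans (hcardK.trans e2))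
    omega
  have hAlg : ShaUnboundedOfCorank := by
    intro W _ p hp hcor n
    have hpp : p.Prime := hp.out
    by_contra hno
    push Not at hno
    apply hcor
    -- the `p`-primary part `A = Ш[p^∞]` of `Ш(W)`
    set A : AddSubgroup ↥W.sha := AddCommGroup.primaryComponent (↥W.sha) p
    show Literature.NumberTheory.EllipticCurves.zpCorank (↥A) p = 0
    -- (B1) `p ^ n` kills `A`: an element of order `p ^ m`, `m ≥ n`, would have a multiple of exact order `p ^ n`
    have hkill : ∀ a : ↥A, p ^ n • a = 0 := by
      intro a
      obtain ⟨k, hk⟩ : ∃ k : ℕ, p ^ k • (a : ↥W.sha) = 0 := a.2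
      have hdvd : addOrderOf (a : ↥W.sha) ∣ p ^ k := addOrderOf_dvd_of_nsmul_eq_zero hk
      obtain ⟨m, -, hm⟩ := (Nat.dvd_prime_pow hpp).1 hdvd
      by_cases hmn : n ≤ m
      · exfalso
        have hne : addOrderOf (a : ↥W.sha) ≠ 0 := by rw [hm]; exact pow_ne_zero _ hpp.ne_zero
        have hdiv : p ^ n ∣ addOrderOf (a : ↥W.sha) := by rw [hm]; exact pow_dvd_pow p hmn
        exact hno _ (addOrderOf_nsmul_addOrderOf_sub hne hdiv)
      · push Not at hmn
        have hdiv : addOrderOf (a : ↥W.sha) ∣ p ^ n := by rw [hm]; exact pow_dvd_pow p hmn.le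
        apply Subtype.ext
        rw [AddSubgroupClass.coe_nsmul, ZeroMemClass.coe_zero]
        exact addOrderOf_dvd_iff_nsmul_eq_zero.mp hdiv
    -- (B2) `A[p]` is finite: otherwise its `finrank` is the junk value `0` and the corank formula is `0`
    haveI hfinp : Finite ↥(AddSubgroup.torsionBy (↥A) (p : ℤ)) := by
      by_contra hinf
      apply hcor
      show Literature.NumberTheory.EllipticCurves.zpCorank (↥A) p = 0
      unfold Literature.NumberTheory.EllipticCurves.zpCorank
      letI : Module (ZMod p) (AddSubgroup.torsionBy (↥A) (p : ℤ)) := AddSubgroup.torsionBy.zmodModule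
      have h0 : Module.finrank (ZMod p) (AddSubgroup.torsionBy (↥A) (p : ℤ)) = 0 := by
        apply Module.finrank_of_not_finite
        intro hf
        exact hinf (Module.finite_of_finite (ZMod p))
      rw [h0, Nat.zero_sub]
    -- (B3) hence `A = A[p^n]` is finite and (A) applies
    haveI : Finite ↥(AddSubgroup.torsionBy (↥A) ((p ^ n : ℕ) : ℤ)) :=
      Literature.NumberTheory.EllipticCurves.finite_torsionBy_pow (↥A) p n
    haveI : Finite ↥A :=
      Finite.of_injective
        (fun a : ↥A => (⟨a, AddSubgroup.torsionBy.nsmul_iff.mpr (hkill a)⟩ :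
          ↥(AddSubgroup.torsionBy (↥A) ((p ^ n : ℕ) : ℤ))))
        (fun a b h => by simpa using congrArg Subtype.val h)
    exact hzero (↥A) p
  -- support item `CruxesToTarget` (the glue cruxes → X), proved inline: Ш-cotorsion by contradiction
  -- (positive corank ⇒ Ш-elements of every order p^n ⇒ accidental zeros at every depth, against isolation),
  -- Selmer-BSD by the surjective / non-surjective case split
  have hG : CruxesToTarget := by
    intro hIso hSh hAlg hUB hLB hSI W _ _ p _ h5 hgood hord hirr
    refine ⟨?_, ?_⟩
    · by_contra hne
      obtain ⟨n₀, hn₀⟩ := hIso W p h5 hgood hord hirr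
      obtain ⟨σ, hσ⟩ := hAlg W p hne (max n₀ 1)
      exact hn₀ (max n₀ 1) (le_max_left _ _)
        (hSh W p h5 hgood hord hirr (max n₀ 1) (le_max_right _ _) ⟨σ, hσ⟩)
    · by_cases hsurj : W.HasSurjectiveModNGaloisRep p
      · exact le_antisymm (hUB W p h5 hgood hord hsurj) (hLB W p h5 hgood hord hsurj)
      · exact hSI W p h5 hgood hord hsurj
  have hT : ShadowIsolationThesis := hG hIso hSh hAlg hUB hLB hSI
  -- Greenberg's corank identity `corank Sel_{p^∞} = rank + corank Ш[p^∞]`, discharged in tree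
  have hId : ∀ (W : WeierstrassCurve ℚ) [W.IsElliptic] (p : ℕ) [Fact p.Prime],
      W.selmerCorank p = W.mordellWeilRank + W.shaCorank p :=
    fun W _ p _ => W.selmerCorank_eq_mordellWeilRank_add_holds p
  -- (T1) the Mordell–Weil rank is an isomorphism invariant (AEC III.3.1(b); `VariableChangePoints`)
  have hMW : ∀ (W : WeierstrassCurve ℚ) (C : WeierstrassCurve.VariableChange ℚ),
      (C • W).mordellWeilRank = W.mordellWeilRank := fun W C =>
    @WeierstrassCurve.VariableChange.finrank_point_variableChange ℚ _ W C (Classical.decEq ℚ)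
  -- (T2) the local Euler factor over the fraction field of a DVR is an isomorphism invariant
  -- (AEC VII.1.3(b), VII.2, VII.5.1, App. C §16), as in route SelmerRank's certified `closes`
  have hloc : ∀ (R : Type) [CommRing R] [IsDomain R] [IsDiscreteValuationRing R]
      (K : Type) [Field K] [Algebra R K] [IsFractionRing R K]
      (W : WeierstrassCurve K) [W.IsElliptic] (C : WeierstrassCurve.VariableChange K),
      (C • W).localEulerFactor R = W.localEulerFactor R := by
    intro R _ _ _ K _ _ _ W _ C
    obtain ⟨D, hD⟩ : ∃ D : WeierstrassCurve.VariableChange K,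
        (C • W).minimal R = D • W.minimal R :=
      ⟨((C • W).exists_isMinimal R).choose * C * ((W.exists_isMinimal R).choose)⁻¹, by
        rw [WeierstrassCurve.minimal, WeierstrassCurve.minimal, mul_smul, mul_smul, inv_smul_smul]⟩
    haveI hE : (W.minimal R).IsElliptic := by rw [WeierstrassCurve.minimal]; infer_instance
    have hΔ : (W.minimal R).Δ ≠ 0 := (W.minimal R).isUnit_Δ.ne_zero
    have hgood : ((C • W).minimal R).HasGoodReduction R ↔ (W.minimal R).HasGoodReduction R := by
      rw [WeierstrassCurve.hasGoodReduction_iff, WeierstrassCurve.hasGoodReduction_iff,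
        WeierstrassCurve.valuation_Δ_eq_of_isMinimal_of_eq_smul R hD]
      exact and_congr_left' ⟨fun _ => inferInstance, fun _ => inferInstance⟩
    have hcard : Nat.card (((C • W).minimal R).reduction R).toAffine.Point =
        Nat.card ((W.minimal R).reduction R).toAffine.Point := by
      obtain ⟨E, hE⟩ := WeierstrassCurve.exists_reduction_eq_smul R hD hΔ
      rw [hE]
      exact WeierstrassCurve.natCard_point_smul _ _
    have hpoly : (C • W).localPolynomial R = W.localPolynomial R := by
      classical
      unfold WeierstrassCurve.localPolynomial
      simp only [hgood, hcard,
        WeierstrassCurve.hasSplitMultiplicativeReduction_iff_of_isMinimal_of_eq_smul R hD hΔ,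
        WeierstrassCurve.hasMultiplicativeReduction_iff_of_isMinimal_of_eq_smul R hD hΔ]
    simp only [WeierstrassCurve.localEulerFactor, WeierstrassCurve.localPowerSeries, hpoly]
  -- (T3) hence the analytic rank `ord_{s=1} L(E,s)` is an isomorphism invariant (AEC App. C §16)
  have hAn : ∀ (W : WeierstrassCurve ℚ) [W.IsElliptic] (C : WeierstrassCurve.VariableChange ℚ),
      (C • W).analyticRank = W.analyticRank := by
    intro W _ C
    have hL : (C • W).LFunction = W.LFunction := by
      unfold WeierstrassCurve.LFunction
      congr 1
      funext v
      simp only [WeierstrassCurve.baseChange, ← WeierstrassCurve.map_variableChange]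
      exact hloc _ _ _ _
    have hLS : (C • W).LSeries = W.LSeries := by
      funext s
      simp only [WeierstrassCurve.LSeries, hL]
    have hEC : (C • W).entireContinuations = W.entireContinuations := by
      simp only [WeierstrassCurve.entireContinuations, hLS]
    have hEL : (C • W).entireLFunction = W.entireLFunction := by
      unfold WeierstrassCurve.entireLFunction
      rw [hEC, hLS]
    simp only [WeierstrassCurve.analyticRank, hEL]
  -- ASSEMBLY WITHOUT `R`: pass to a global minimal model `C • W`, take a good ordinary prime `p ≥ 5`
  -- with `E[p]` IRREDUCIBLE from the hypothesis `hPS : PrimeSupplyIrreducible` (item 15491),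
  -- apply X there, conclude by Greenberg's identity and transport back along `C`
  intro W hW
  obtain ⟨C, hC⟩ := WeierstrassCurve.hasGlobalMinimalModel_rat_holds W
  obtain ⟨p, hp, h5, hgood, hord, hirr⟩ := hPS (C • W)
  have h2 : (C • W).selmerCorank p = (C • W).mordellWeilRank + (C • W).shaCorank p := hId (C • W) p
  have h6 := hMW W C
  have h7 := hAn W C
  obtain ⟨hsha, hsel⟩ := hT (C • W) p h5 hgood hord hirr
  omega

end Summit.BirchSwinnertonDyer.BirchSwinnertonDyer.Cruxes.ShaCotorsionReducible
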